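import Summits.QuantumAdvantage.QuantumAdvantage.Theorems.CubicForrelationNearExactIsExactKtGapTwoCubic

/-!
# Crux `CubicForrelation.NearExactIsExact` (stmt-QuantumAdvantage-14043) — n = 12, type O AT `Φ ≥ 932/1024`: the base set has `896` or `960` points
  (shape lemma for the NEXT rung `932/1024`)

Certificate seat `b2b-cforr-cert` (gen 18).  HONEST FRAMING: a kernel-checked structure lemma (standard axioms) for the type-O branch of the rung
`932/1024 = 233/256` — NOT closed here; NO new value of `θ₁₂`.  NOT summit progress.

`to18_typeO_ge932_shape`: a type-O side (`W_g = 16u`, some `u` odd) with `Φ ≥ 932/1024` has a cubic base set `E = {d₁ = d₂}` with `#E = 896` or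
`#E = 960`, and the budget `Σ τ² ≤ 11776 = 4096 + 8·960`: the budget gives `#E ≤ 960`, `to15_typeO_E_ge_768` / `to15_typeO_E768_le` give
`#E > 768`, and the two classification-free Kasami–Tokura gaps `kt_gap_twelve` (`(768, 896)`) and `kt_gap2_twelve` (`(896, 960)`) leave `896`
and `960`.  So at `932/1024` exactly two type-O configurations remain: `#E = 960` at ZERO excess (by Kasami–Tokura's classification, affinely
`x₁·q₈`), and `#E = 896` with excess `≤ 512` (`to18_typeO_E896_false` kills it only for `Φ > 932/1024`).  `to18_typeO_E960_zero_excess`: in the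
case `#E = 960` every point has zero excess, `u − 4(−1)^f = τ₀ ∈ {±1, ±3}`, and `Φ = 932/1024` exactly.

References: Kasami–Tokura (1970); MacWilliams–Sloane (1977) Ch. 15.  Axioms: the standard three.
-/

set_option linter.dupNamespace false -- D-0017: single-problem summit ⇒ `QuantumAdvantage.QuantumAdvantage` by design

noncomputable section

namespace Summit.QuantumAdvantage.QuantumAdvantage.Theorems.CubicForrelation.NearExactIsExact

open Finset
open Literature.Computability.QuantumComplexity
open Literature.Computability.QuantumComplexity.BuzetChailloux (bxor zeroVec bxor_bxor_cancel_left bxor_zeroVec zeroVec_bxor bxor_comm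
  bxor_self twist_zeroVec_right twist_bxor_right)
open Literature.Computability.QuantumComplexity.DerivativeWalsh (W)
open Summit.QuantumAdvantage.QuantumAdvantage.Theorems.NearExactIsExact.Negative (TypeOTwelve.typeO_of_exists_odd)

/-- **Shape of a type-O side at `Φ ≥ 932/1024`: base set `896` or `960`, budget `Σ τ² ≤ 11776`.**  See the module docstring.  NOT summit
progress. [this work] -/
theorem to18_typeO_ge932_shape (f g : (Fin (6 + 6) → Bool) → Bool) (hf : IsDegLeFun 3 f) (hg : IsDegLeFun 3 g)
    (u : (Fin (6 + 6) → Bool) → ℤ) (hu : ∀ x, W (fun y => signOf (g y)) x = (2 : ℝ) ^ 4 * (u x : ℝ))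
    (hodd : ∃ x, Odd (u x)) (hΦ : (932 / 1024 : ℝ) ≤ forrelation f g) :
    (#(univ.filter fun x : Fin (6 + 6) → Bool => (Odd (u x / 2) ↔ Odd (u x / 2 / 2))) = 896 ∨
      #(univ.filter fun x : Fin (6 + 6) → Bool => (Odd (u x / 2) ↔ Odd (u x / 2 / 2))) = 960) ∧
    (∑ x, (u x - 4 * sZ (f x)) ^ 2 : ℤ) ≤ 11776 := by
  classical
  have hall : ∀ x, Odd (u x) := TypeOTwelve.typeO_of_exists_odd g u hg hu hodd
  have hu' : ∀ x, W (fun y => signOf (g y)) x = (2 : ℝ) ^ (2 * 2) * (u x : ℝ) := fun x => (hu x).trans (by norm_num)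
  have hd1 : IsDegLeFun 1 (fun x => decide (Odd (u x / 2))) := z2_digitOne 2 g u hg hu' hall
  have hd2 : IsDegLeFun 3 (fun x => decide (Odd (u x / 2 / 2))) := z2_digitTwo 2 g u hg hu' hall
  set E := univ.filter (fun x : Fin (6 + 6) → Bool => (Odd (u x / 2) ↔ Odd (u x / 2 / 2))) with hEdef
  have hdegE : IsDegLeFun (2 + 1) (fun x => (decide (Odd (u x / 2)) ^^ decide (Odd (u x / 2 / 2))) ^^ true) :=
    tb_isDegLeFun_xor_const (bb_isDegLeFun_bxor (hd1.mono (by norm_num)) hd2) true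
  have hsetE : (univ.filter fun x : Fin (6 + 6) → Bool =>
      ((decide (Odd (u x / 2)) ^^ decide (Odd (u x / 2 / 2))) ^^ true) = true) = E := by
    rw [hEdef]
    apply filter_congr
    intro x _
    by_cases h1 : Odd (u x / 2) <;> by_cases h2 : Odd (u x / 2 / 2) <;> simp [h1, h2]
  have hsumE : (∑ x, (if (Odd (u x / 2) ↔ Odd (u x / 2 / 2)) then 1 else 0 : ℤ)) = #E := by rw [sum_boole]
  -- `#E ≥ 768`, `#E ≠ 768`
  have hE768 : 768 ≤ #E := to15_typeO_E_ge_768 f g hf hg u hu hodd (by linarith)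
  have hEne : #E ≠ 768 := by
    intro h
    have := to15_typeO_E768_le f g hf hg u hu hodd h
    linarith
  -- budget: `4096 + 8#E ≤ Σ τ² = 2¹⁷(1 − Φ) ≤ 11776`
  have hbud := tw12_budget f g u hu
  have hT : (∑ x, (u x - 4 * sZ (f x)) ^ 2 : ℤ) ≤ 11776 := by
    have h' : ((∑ x, (u x - 4 * sZ (f x)) ^ 2 : ℤ) : ℝ) ≤ 11776 := by rw [hbud]; linarith
    exact_mod_cast h'
  choose v hv using fun x => to12_pt_mod8 (u x) (sZ (f x)) (hall x) (tp_sZ_cases (f x))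
  set τ₀ : (Fin (6 + 6) → Bool) → ℤ := fun x =>
    sZ (decide (Odd (u x / 2))) * (1 - 4 * (if (Odd (u x / 2) ↔ Odd (u x / 2 / 2)) then 1 else 0)) with hτ₀def
  have hτ₀val : ∀ x, τ₀ x = 1 ∨ τ₀ x = -1 ∨ τ₀ x = 3 ∨ τ₀ x = -3 := by
    intro x
    simp only [τ₀]
    rcases tp_sZ_cases (decide (Odd (u x / 2))) with h | h <;> rw [h] <;> split_ifs <;> norm_num
  have hτ₀sq : ∀ x, τ₀ x ^ 2 = 1 + 8 * (if (Odd (u x / 2) ↔ Odd (u x / 2 / 2)) then 1 else 0 : ℤ) := by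
    intro x
    simp only [τ₀]
    rcases tp_sZ_cases (decide (Odd (u x / 2))) with h | h <;> rw [h] <;> split_ifs <;> norm_num
  have hsumτ₀ : ∑ x, τ₀ x ^ 2 = 4096 + 8 * #E := by
    rw [sum_congr rfl fun x _ => hτ₀sq x, sum_add_distrib, ← mul_sum, hsumE, sum_const, card_univ, Fintype.card_fun,
      Fintype.card_bool, Fintype.card_fin]
    norm_num
  have hTge : ∑ x, τ₀ x ^ 2 ≤ (∑ x, (u x - 4 * sZ (f x)) ^ 2 : ℤ) := by
    refine sum_le_sum fun x _ => ?_
    rw [hv x]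
    linarith [to12_excess_nonneg (τ₀ x) (v x) (hτ₀val x)]
  have hE960 : #E ≤ 960 := by
    rw [hsumτ₀] at hTge
    have : (8 : ℤ) * #E ≤ 7680 := by linarith
    have : 8 * #E ≤ 7680 := by exact_mod_cast this
    omega
  refine ⟨?_, hT⟩
  -- the two Kasami–Tokura gaps
  by_cases h896 : #E < 896
  · exfalso
    exact kt_gap_twelve _ hdegE (by rw [hsetE]; omega) (by rw [hsetE]; exact h896)
  by_cases h896' : #E = 896
  · exact Or.inl h896'
  by_cases h960 : #E = 960
  · exact Or.inr h960
  exfalso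
  exact kt_gap2_twelve _ hdegE (by rw [hsetE]; omega) (by rw [hsetE]; omega)

/-- **Type O with `#E = 960` at `Φ ≥ 932/1024`: zero excess everywhere and `Φ = 932/1024` exactly.**  With `#E = 960` the base energy
`4096 + 8·960 = 11776` exhausts the budget, so `u − 4(−1)^f = τ₀ ∈ {±1, ±3}` pointwise and `Σ τ² = 11776`, i.e. `Φ = 932/1024`.  (This is the
one surviving type-O configuration at `233/256` besides `#E = 896` with excess `≤ 512`.)  NOT summit progress. [this work] -/
theorem to18_typeO_E960_zero_excess (f g : (Fin (6 + 6) → Bool) → Bool) (hg : IsDegLeFun 3 g)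
    (u : (Fin (6 + 6) → Bool) → ℤ) (hu : ∀ x, W (fun y => signOf (g y)) x = (2 : ℝ) ^ 4 * (u x : ℝ))
    (hodd : ∃ x, Odd (u x)) (hE : #(univ.filter fun x : Fin (6 + 6) → Bool => (Odd (u x / 2) ↔ Odd (u x / 2 / 2))) = 960)
    (hΦ : (932 / 1024 : ℝ) ≤ forrelation f g) :
    (∀ x, u x - 4 * sZ (f x) = sZ (decide (Odd (u x / 2))) * (1 - 4 * (if (Odd (u x / 2) ↔ Odd (u x / 2 / 2)) then 1 else 0))) ∧
    forrelation f g = 932 / 1024 := by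
  classical
  have hall : ∀ x, Odd (u x) := TypeOTwelve.typeO_of_exists_odd g u hg hu hodd
  set E := univ.filter (fun x : Fin (6 + 6) → Bool => (Odd (u x / 2) ↔ Odd (u x / 2 / 2))) with hEdef
  have hsumE : (∑ x, (if (Odd (u x / 2) ↔ Odd (u x / 2 / 2)) then 1 else 0 : ℤ)) = #E := by rw [sum_boole]
  have hbud := tw12_budget f g u hu
  have hT : (∑ x, (u x - 4 * sZ (f x)) ^ 2 : ℤ) ≤ 11776 := by
    have h' : ((∑ x, (u x - 4 * sZ (f x)) ^ 2 : ℤ) : ℝ) ≤ 11776 := by rw [hbud]; linarith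
    exact_mod_cast h'
  choose v hv using fun x => to12_pt_mod8 (u x) (sZ (f x)) (hall x) (tp_sZ_cases (f x))
  set τ₀ : (Fin (6 + 6) → Bool) → ℤ := fun x =>
    sZ (decide (Odd (u x / 2))) * (1 - 4 * (if (Odd (u x / 2) ↔ Odd (u x / 2 / 2)) then 1 else 0)) with hτ₀def
  have hτ₀val : ∀ x, τ₀ x = 1 ∨ τ₀ x = -1 ∨ τ₀ x = 3 ∨ τ₀ x = -3 := by
    intro x
    simp only [τ₀]
    rcases tp_sZ_cases (decide (Odd (u x / 2))) with h | h <;> rw [h] <;> split_ifs <;> norm_num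
  have hτ₀sq : ∀ x, τ₀ x ^ 2 = 1 + 8 * (if (Odd (u x / 2) ↔ Odd (u x / 2 / 2)) then 1 else 0 : ℤ) := by
    intro x
    simp only [τ₀]
    rcases tp_sZ_cases (decide (Odd (u x / 2))) with h | h <;> rw [h] <;> split_ifs <;> norm_num
  have hsumτ₀ : ∑ x, τ₀ x ^ 2 = 11776 := by
    rw [sum_congr rfl fun x _ => hτ₀sq x, sum_add_distrib, ← mul_sum, hsumE, sum_const, card_univ, Fintype.card_fun,
      Fintype.card_bool, Fintype.card_fin]
    change (4096 : ℕ) • (1 : ℤ) + 8 * ((#E : ℕ) : ℤ) = 11776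
    rw [hE]; norm_num
  have hXnn : ∀ x, 0 ≤ (τ₀ x + 8 * v x) ^ 2 - τ₀ x ^ 2 := fun x => to12_excess_nonneg _ _ (hτ₀val x)
  have hTdec : (∑ x, (u x - 4 * sZ (f x)) ^ 2 : ℤ) = ∑ x, τ₀ x ^ 2 + ∑ x, ((τ₀ x + 8 * v x) ^ 2 - τ₀ x ^ 2) := by
    rw [← sum_add_distrib]
    exact sum_congr rfl fun x _ => by rw [hv x]; ring
  have hXsum0 : ∑ x, ((τ₀ x + 8 * v x) ^ 2 - τ₀ x ^ 2) = 0 := by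
    apply le_antisymm _ (sum_nonneg fun x _ => hXnn x)
    linarith
  have hX0 : ∀ x, (τ₀ x + 8 * v x) ^ 2 - τ₀ x ^ 2 = 0 := fun x =>
    (sum_eq_zero_iff_of_nonneg fun y _ => hXnn y).1 hXsum0 x (mem_univ x)
  have hτ : ∀ x, u x - 4 * sZ (f x) = τ₀ x := by
    intro x
    have hv0 : v x = 0 := by
      by_contra hne
      have h1 : 1 ≤ v x ∨ v x ≤ -1 := by omega
      have h2 := to12_excess _ _ 1 (hτ₀val x) le_rfl h1
      have h3 := hX0 x
      linarith
    rw [hv x, hv0]; ring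
  refine ⟨hτ, ?_⟩
  have hTeq : (∑ x, (u x - 4 * sZ (f x)) ^ 2 : ℤ) = 11776 := by rw [hTdec, hXsum0, hsumτ₀]; ring
  have hTeqR : ((∑ x, (u x - 4 * sZ (f x)) ^ 2 : ℤ) : ℝ) = 11776 := by exact_mod_cast hTeq
  rw [hbud] at hTeqR
  linarith

end Summit.QuantumAdvantage.QuantumAdvantage.Theorems.CubicForrelation.NearExactIsExact

end
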